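import Summits.QuantumFields.YangMills.Theorems.BalabanUVNodesN11ChiTopRegularity
import Summits.QuantumFields.YangMills.Theorems.BalabanUVNodesN11Data7TopZeroOfRead

/-!
# DAG node N11 — THE CHARGED SEPARATED JUNCTION WITH ITS TOP-REGULARITY HALF DISCHARGED: hJ of `…SpaceTruncationChargedSep` from [15]-solvability on the χ-support,
# the (7)-data half, the cube cover and numerics (`2 ≤ cR`) — and the two no-expansion 𝐓-step faces re-keyed on exactly these rows

HEADER — WORK-UNIT METADATA.  Cell `pub-ymgap`, YM-PLAN Track A (HUMAN RULING D-0062), seat `pub-ymgap-dag-n11-d` (g12; R134 fan-out seat N11 [B14], strategy s2),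
route `BalabanUVNodes`, item K1⁷ `StabilityBAtRecordR13SepCoPH` = stmt-QuantumFields-20542 (helper, `--kind proof --supports 20542 --as helper`, count-neutral).
[III] = [Balaban1988Convergent], [15] = [Balaban1985Variational], [B7] = [Balaban1985Averaging].  Over this seat's `…N11ChiTopRegularity` (★★★★
`plaqSmallOn_genSet_top_of_chiSeqOfRecord_ne_zero_of_solvable`), `…N11Data7TopZeroOfRead` (level-0 (7)-clause) and `…N11SpaceTruncationChargedSep` (`sepJunctionCharged_of_top`, the two ★ faces).

WHY THIS FILE.  The junction hJ at charged separated indices splits (p591971 `sepJunction_of_top`) into a TOP clause «`χ_k(s₀)(W_k) ≠ 0 ⇒` `W_k` is `cR·ε_k`-regular on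
`Γ_k`» and the (7)-data clause `DataSmall7PTop`.  `…N11ChiTopRegularity` proves the top clause with `cR = 2` from solvability of the (2.16) problems inside `χ_k` (K0's [15] row),
the cube cover and numerics.  Here the junction and both faces are re-keyed accordingly: the rows a discharger of the no-expansion 𝐓-step now owes are — per charged separated index —
SOLVABILITY on the χ-support, the (7)-DATA clause AT LEVELS `≥ 1` (mixed fields; level 0 is the reading support's own scale-0 clause, `…Data7TopZeroOfRead`), the cube
cover, and the numerics `2 ≤ θ.s2.cR`, `ε_k` in Prop. 2's range, the cube side against the averaging boxes.

WHAT THIS FILE PROVES (0 `sorry`, 0 `def`).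
* ★★ `sepJunctionCharged_of_solvable` — hJ (Γr := print's `readSelOfSeq`, letter `θ.s2.cR`) from the four rows above (`1 ≤ k ≤ m + K`).
* ★★★ `exists_local_witness_clause_succ_of_sLaw₁₃CoPH_of_sep_of_solvable` ∕ ★★★ `…_of_hasSect2FormAtZS_of_borelB_of_sep_of_solvable` — the two faces of
  `…SpaceTruncationChargedSep` with hJ REPLACED by those rows (conclusions VERBATIM).

HONEST FRAMING.  Helper lane of K1⁷; pure composition; nothing of [III] ∕ [15] asserted (solvability, (7)-data, cover, numerics are HYPOTHESES — K0 ∕ def-R rows; K0a's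
`cR := 1`, `M = M₂ = 1` meet NEITHER `2 ≤ cR` NOR the cover, located).  N11 NOT discharged; K1⁷ NOT closed; counts unmoved (typed 28∕28 · discharged 5∕27).  One finite
four-torus programme at fixed `ε = L^{−K}` — NOT ℝ⁴, NOT OS, NOT a mass gap, NOT Clay.  No `sorry`, `axiom`, `def`, `instance`, `notation`.  Sources: [III] (2.10) p.256,
(2.16)–(2.17) p.257, (2.28) p.259, p.267, Thm 1 p.262, (3.24)–(3.25) p.270; [15] (7)–(8) p.278–279; [B7] Prop. 2 p.26; [Balaban1985RegularSpaces] (1.3)–(1.6) p.77.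
-/

noncomputable section

open MeasureTheory
open scoped BigOperators ENNReal NNReal Matrix.Norms.L2Operator

namespace Summit.QuantumFields.YangMills.Theorems.BalabanUVNodesN11ChargedSepJunctionOfSolvable

open Literature.MathematicalPhysics.QuantumFieldTheory.Balaban1983to89 T4Continuum T4NestedCovariance Node00 Node00.Tk DagBinding
open B15DeterminingSets B8Eq17ClassAkV1 B14.Eq218Concrete
open B14.Eq213MaximalDomains (side)
open B14.Eq213DetSet (Bj)
open B14.Eq216Concrete (ukBox)
open Literature.MathematicalPhysics.QuantumFieldTheory.BalabanImbrieJaffe1984to88.BIJ85Eq453GaugeField (qsstarGIter0)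
open BalabanUVNodesN11FluctTruncationDefs (IsFluctLocal)
open BalabanUVNodesN11SpaceTruncationDefs BalabanUVNodesN11SpaceTruncationBorelBDefs
open BalabanUVNodesN11ChiTopRegularity (plaqSmallOn_genSet_top_of_chiSeqOfRecord_ne_zero_of_solvable)
open BalabanUVNodesN11Data7TopZeroOfRead (plaqSmallOn_printedPlaqsTop_of_readSel_zero)
open BalabanUVNodesN11SpaceTruncationChargedSep (sepJunctionCharged_of_top exists_local_witness_clause_succ_of_sLaw₁₃CoPH_of_sep_of_junctionCharged
  exists_local_witness_clause_succ_of_hasSect2FormAtZS_of_borelB_of_sep_of_junctionCharged)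

variable {F : T4Family} {N : ℕ} [NeZero N]

variable (θ : Stage13HParams F N) (p : B12.RunParams)

/-- **★★ THE CHARGED SEPARATED JUNCTION FROM SOLVABILITY, THE (7)-DATA, THE CUBE COVER AND NUMERICS** (`1 ≤ k ≤ m + K`, print's reading regions `readSelOfSeq`, letter
`θ.s2.cR` with `2 ≤ cR`): the top-regularity half is `…N11ChiTopRegularity`'s ★★★★ at `2ε_k ≤ cR·ε_k`; the (7)-data half AT LEVELS `1 ≤ m+1 ≤ k` (mixed fields; its level-0 clause is the reading support's scale-0 clause, `…Data7TopZeroOfRead`), per-cube solvability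
on the χ-support and the cover of `Ω_k(s₀)` by the χ-cubes it contains are DISPLAYED rows (K0 ∕ def-R). [cite: Balaban1988Convergent, (2.10) p.256, (2.16)–(2.17) p.257, p.267, (2.28) p.259; Balaban1985Variational, Thm 1 (7)–(8) p.278–279; Balaban1985Averaging, Prop. 2 p.26; Balaban1985RegularSpaces, (1.3)–(1.6) p.77] -/
theorem sepJunctionCharged_of_solvable {k : ℕ} (hk : 1 ≤ k) (hkK : k ≤ (F.P p.K).m + (F.P p.K).K) (hcR : 2 ≤ θ.s2.cR) (hM : 1 ≤ θ.ν.M₁)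
    (h3 : 3 * side (F.P p.K).L θ.ν.M₁ k ≤ cubeSide (F.P p.K).L θ.ν.M₂ (RkOfRecord (F.P p.K).L θ.ν.r (gOfRecord₁₃ F N θ.toStage13Params p k)) k)
    (hR : (F.P p.K).L ^ k + (((F.P p.K).d + 4) * (F.P p.K).L + 2) * (∑ l ∈ Finset.range k, (F.P p.K).L ^ l) + 2 ≤
      cubeSide (F.P p.K).L θ.ν.M₂ (RkOfRecord (F.P p.K).L θ.ν.r (gOfRecord₁₃ F N θ.toStage13Params p k)) k)
    (hε : 0 < epsOfRecord θ.ν (gOfRecord₁₃ F N θ.toStage13Params p) k)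
    (hε3 : (143 * (((((F.P p.K).d + 4 : ℕ) : ℝ)) ^ 2 / 4) ^ 2) * epsOfRecord θ.ν (gOfRecord₁₃ F N θ.toStage13Params p) k ≤ 1 / 3)
    (hε2 : 2 * epsOfRecord θ.ν (gOfRecord₁₃ F N θ.toStage13Params p) k ≤ 2 * ExpMeanLog.deltaSU (Fin N) / ((((F.P p.K).d + 4) * (F.P p.K).L : ℕ) : ℝ) ^ 2)
    (hsolv : ∀ s₀ : SeqOfRecord F θ.ν θ.τ9.M (gOfRecord₁₃ F N θ.toStage13Params p) p.K k,
      slotsOfRecord F N θ.ν θ.τ9 (EOfRecord₁₃ F N θ.toStage13Params) (wOfRecord₉ F N θ.toStage9Params) θ.ppSel p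
        (gOfRecord₁₃ F N θ.toStage13Params p) k s₀ ≠ 0 → Sect2.SeqSeparated θ.ν.M₁ s₀ → ∀ Wc : MSField (F.P p.K) (SU N),
      chiSeqOfRecord F N θ.ν θ.τ9.M (gOfRecord₁₃ F N θ.toStage13Params p) p.K k s₀ (Wc k) ≠ 0 →
      ∀ a ∈ cubesIn (fun a : ↥(cubeIndices (F.P p.K) (cubeSide (F.P p.K).L θ.ν.M₂ (RkOfRecord (F.P p.K).L θ.ν.r (gOfRecord₁₃ F N θ.toStage13Params p k)) k)) =>
          cubeEnl (F.P p.K) (cubeSide (F.P p.K).L θ.ν.M₂ (RkOfRecord (F.P p.K).L θ.ν.r (gOfRecord₁₃ F N θ.toStage13Params p k)) k) a 0) (s₀.Ω k),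
        ∃ U₀, IsMinimizer (avOfRecord F N p.K) {U | PlaqSmall (θ.ν.εreg * (F.P p.K).eta k ^ 2) U}
          (Bj θ.ν.M₁ (cubeEnl (F.P p.K) (cubeSide (F.P p.K).L θ.ν.M₂ (RkOfRecord (F.P p.K).L θ.ν.r (gOfRecord₁₃ F N θ.toStage13Params p k)) k) a 4) k)
          (avgFamily (avOfRecord F N p.K) (qsstarGIter0 k (Wc k))) U₀)
    (hcov : ∀ s₀ : SeqOfRecord F θ.ν θ.τ9.M (gOfRecord₁₃ F N θ.toStage13Params p) p.K k,
      s₀.Ω k ⊆ ⋃ a ∈ cubesIn (fun a : ↥(cubeIndices (F.P p.K) (cubeSide (F.P p.K).L θ.ν.M₂ (RkOfRecord (F.P p.K).L θ.ν.r (gOfRecord₁₃ F N θ.toStage13Params p k)) k)) =>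
          cubeEnl (F.P p.K) (cubeSide (F.P p.K).L θ.ν.M₂ (RkOfRecord (F.P p.K).L θ.ν.r (gOfRecord₁₃ F N θ.toStage13Params p k)) k) a 0) (s₀.Ω k),
        cubeEnl (F.P p.K) (cubeSide (F.P p.K).L θ.ν.M₂ (RkOfRecord (F.P p.K).L θ.ν.r (gOfRecord₁₃ F N θ.toStage13Params p k)) k) a 0)
    (h7 : ∀ s₀ : SeqOfRecord F θ.ν θ.τ9.M (gOfRecord₁₃ F N θ.toStage13Params p) p.K k,
      slotsOfRecord F N θ.ν θ.τ9 (EOfRecord₁₃ F N θ.toStage13Params) (wOfRecord₉ F N θ.toStage9Params) θ.ppSel p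
        (gOfRecord₁₃ F N θ.toStage13Params p) k s₀ ≠ 0 → Sect2.SeqSeparated θ.ν.M₁ s₀ → ∀ Wc : MSField (F.P p.K) (SU N),
      chiSeqOfRecord F N θ.ν θ.τ9.M (gOfRecord₁₃ F N θ.toStage13Params p) p.K k s₀ (Wc k) ≠ 0 →
      (∀ j, j < k → PlaqSmallOn (plaqsOf (pts j (readSelOfSeq F p (suppDomOfRecord F θ.ν p.K s₀.Ω) s₀.Ω j (s₀.Ω (j + 1))ᶜ)))
        (θ.s2.cR * epsOfRecord θ.ν (gOfRecord₁₃ F N θ.toStage13Params p) j) (Wc j)) →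
      ∀ m, m + 1 ≤ k → PlaqSmallOn (Sect2.printedPlaqs s₀.Ω k (m + 1)) (θ.s2.cR * epsOfRecord θ.ν (gOfRecord₁₃ F N θ.toStage13Params p) (m + 1))
        (Sect2.mixedField (avOfRecord F N p.K) (genSet s₀.Ω k (m + 1)) (Wc (m + 1)) (Wc m))) :
    ∀ s₀ : SeqOfRecord F θ.ν θ.τ9.M (gOfRecord₁₃ F N θ.toStage13Params p) p.K k,
      slotsOfRecord F N θ.ν θ.τ9 (EOfRecord₁₃ F N θ.toStage13Params) (wOfRecord₉ F N θ.toStage9Params) θ.ppSel p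
        (gOfRecord₁₃ F N θ.toStage13Params p) k s₀ ≠ 0 → Sect2.SeqSeparated θ.ν.M₁ s₀ → ∀ Wc : MSField (F.P p.K) (SU N),
      chiSeqOfRecord F N θ.ν θ.τ9.M (gOfRecord₁₃ F N θ.toStage13Params p) p.K k s₀ (Wc k) ≠ 0 →
      (∀ j, j < k → PlaqSmallOn (plaqsOf (pts j (readSelOfSeq F p (suppDomOfRecord F θ.ν p.K s₀.Ω) s₀.Ω j (s₀.Ω (j + 1))ᶜ)))
        (θ.s2.cR * epsOfRecord θ.ν (gOfRecord₁₃ F N θ.toStage13Params p) j) (Wc j)) →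
      Wc ∈ suppOfRecord₁₃SepCoP F N θ.toStage13Params p k s₀ := by
  refine sepJunctionCharged_of_top θ p hk fun s₀ hch hs Wc hχ hlow =>
    ⟨?_, ⟨plaqSmallOn_printedPlaqsTop_of_readSel_zero F θ.ν hM p s₀.Ω hk (hlow 0 hk), h7 s₀ hch hs Wc hχ hlow⟩⟩
  have h2 := plaqSmallOn_genSet_top_of_chiSeqOfRecord_ne_zero_of_solvable (F := F) (N := N) θ.ν θ.τ9.M (gOfRecord₁₃ F N θ.toStage13Params p) p.K k
    hkK s₀ (Wc k) hχ hM h3 hR hε hε3 hε2 (hsolv s₀ hch hs Wc hχ) (hcov s₀)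
  intro q hq
  refine (h2 q hq).trans_le ?_
  exact mul_le_mul_of_nonneg_right hcR hε.le

/-- **★★★ THE SLaw-KEYED NO-EXPANSION 𝐓-STEP FACE WITH THE JUNCTION'S TOP HALF DISCHARGED**: `…SpaceTruncationChargedSep`'s ★ with hJ REPLACED by per-cube
[15]-solvability on the χ-support, the (7)-data clause, the cube cover and the numerics (`2 ≤ cR`, `ε_k` in Prop. 2's range, cube side vs boxes; `1 ≤ k ≤ m + K`); reading
regions = print's `readSelOfSeq`, letter `θ.s2.cR`; conclusion VERBATIM. [cite: Balaban1988Convergent, Theorem p.245, Thm 1 p.262, (2.10) p.256, (2.16)–(2.17) p.257, p.267, (2.28) p.259, (3.24)–(3.25) p.270; Balaban1985Variational, Thm 1 (7)–(8) p.278–279; Balaban1985Averaging, Prop. 2 p.26] -/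
theorem exists_local_witness_clause_succ_of_sLaw₁₃CoPH_of_sep_of_solvable (hsep : θ.Provisos₁₃SepCoPH F N) (hU : θ.ZhUnity F N) (hθ : θ.Admissible F N)
    (hpos : θ.s2.Pos) (hM₁ : 0 < θ.ν.M₁) (hle : θ.ν.M₁ ≤ θ.τ9.M) {k : ℕ} (hk : k < p.K) (hM : 1 ≤ θ.τ9.M)
    (hw : Step.InInterval θ.γ k (gOfRecord₁₃ F N θ.toStage13Params p)) (hPC : PartCompat₁₃ F N θ.toStage13Params p k)
    (hreg : ∀ s₀ : SeqOfRecord F θ.ν θ.τ9.M (gOfRecord₁₃ F N θ.toStage13Params p) p.K k,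
      (θ.zhAt p s₀).RegOn F N (FluctV N) θ.ν θ.s2.cR p (gOfRecord₁₃ F N θ.toStage13Params p) (readSelOfSeq F p (suppDomOfRecord F θ.ν p.K s₀.Ω) s₀.Ω))
    (hk1 : 1 ≤ k) (hkK : k ≤ (F.P p.K).m + (F.P p.K).K) (hcR : 2 ≤ θ.s2.cR)
    (h3 : 3 * side (F.P p.K).L θ.ν.M₁ k ≤ cubeSide (F.P p.K).L θ.ν.M₂ (RkOfRecord (F.P p.K).L θ.ν.r (gOfRecord₁₃ F N θ.toStage13Params p k)) k)
    (hR : (F.P p.K).L ^ k + (((F.P p.K).d + 4) * (F.P p.K).L + 2) * (∑ l ∈ Finset.range k, (F.P p.K).L ^ l) + 2 ≤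
      cubeSide (F.P p.K).L θ.ν.M₂ (RkOfRecord (F.P p.K).L θ.ν.r (gOfRecord₁₃ F N θ.toStage13Params p k)) k)
    (hε : 0 < epsOfRecord θ.ν (gOfRecord₁₃ F N θ.toStage13Params p) k)
    (hε3 : (143 * (((((F.P p.K).d + 4 : ℕ) : ℝ)) ^ 2 / 4) ^ 2) * epsOfRecord θ.ν (gOfRecord₁₃ F N θ.toStage13Params p) k ≤ 1 / 3)
    (hε2 : 2 * epsOfRecord θ.ν (gOfRecord₁₃ F N θ.toStage13Params p) k ≤ 2 * ExpMeanLog.deltaSU (Fin N) / ((((F.P p.K).d + 4) * (F.P p.K).L : ℕ) : ℝ) ^ 2)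
    (hsolv : ∀ s₀ : SeqOfRecord F θ.ν θ.τ9.M (gOfRecord₁₃ F N θ.toStage13Params p) p.K k,
      slotsOfRecord F N θ.ν θ.τ9 (EOfRecord₁₃ F N θ.toStage13Params) (wOfRecord₉ F N θ.toStage9Params) θ.ppSel p
        (gOfRecord₁₃ F N θ.toStage13Params p) k s₀ ≠ 0 → Sect2.SeqSeparated θ.ν.M₁ s₀ → ∀ Wc : MSField (F.P p.K) (SU N),
      chiSeqOfRecord F N θ.ν θ.τ9.M (gOfRecord₁₃ F N θ.toStage13Params p) p.K k s₀ (Wc k) ≠ 0 →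
      ∀ a ∈ cubesIn (fun a : ↥(cubeIndices (F.P p.K) (cubeSide (F.P p.K).L θ.ν.M₂ (RkOfRecord (F.P p.K).L θ.ν.r (gOfRecord₁₃ F N θ.toStage13Params p k)) k)) =>
          cubeEnl (F.P p.K) (cubeSide (F.P p.K).L θ.ν.M₂ (RkOfRecord (F.P p.K).L θ.ν.r (gOfRecord₁₃ F N θ.toStage13Params p k)) k) a 0) (s₀.Ω k),
        ∃ U₀, IsMinimizer (avOfRecord F N p.K) {U | PlaqSmall (θ.ν.εreg * (F.P p.K).eta k ^ 2) U}
          (Bj θ.ν.M₁ (cubeEnl (F.P p.K) (cubeSide (F.P p.K).L θ.ν.M₂ (RkOfRecord (F.P p.K).L θ.ν.r (gOfRecord₁₃ F N θ.toStage13Params p k)) k) a 4) k)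
          (avgFamily (avOfRecord F N p.K) (qsstarGIter0 k (Wc k))) U₀)
    (hcov : ∀ s₀ : SeqOfRecord F θ.ν θ.τ9.M (gOfRecord₁₃ F N θ.toStage13Params p) p.K k,
      s₀.Ω k ⊆ ⋃ a ∈ cubesIn (fun a : ↥(cubeIndices (F.P p.K) (cubeSide (F.P p.K).L θ.ν.M₂ (RkOfRecord (F.P p.K).L θ.ν.r (gOfRecord₁₃ F N θ.toStage13Params p k)) k)) =>
          cubeEnl (F.P p.K) (cubeSide (F.P p.K).L θ.ν.M₂ (RkOfRecord (F.P p.K).L θ.ν.r (gOfRecord₁₃ F N θ.toStage13Params p k)) k) a 0) (s₀.Ω k),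
        cubeEnl (F.P p.K) (cubeSide (F.P p.K).L θ.ν.M₂ (RkOfRecord (F.P p.K).L θ.ν.r (gOfRecord₁₃ F N θ.toStage13Params p k)) k) a 0)
    (h7 : ∀ s₀ : SeqOfRecord F θ.ν θ.τ9.M (gOfRecord₁₃ F N θ.toStage13Params p) p.K k,
      slotsOfRecord F N θ.ν θ.τ9 (EOfRecord₁₃ F N θ.toStage13Params) (wOfRecord₉ F N θ.toStage9Params) θ.ppSel p
        (gOfRecord₁₃ F N θ.toStage13Params p) k s₀ ≠ 0 → Sect2.SeqSeparated θ.ν.M₁ s₀ → ∀ Wc : MSField (F.P p.K) (SU N),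
      chiSeqOfRecord F N θ.ν θ.τ9.M (gOfRecord₁₃ F N θ.toStage13Params p) p.K k s₀ (Wc k) ≠ 0 →
      (∀ j, j < k → PlaqSmallOn (plaqsOf (pts j (readSelOfSeq F p (suppDomOfRecord F θ.ν p.K s₀.Ω) s₀.Ω j (s₀.Ω (j + 1))ᶜ)))
        (θ.s2.cR * epsOfRecord θ.ν (gOfRecord₁₃ F N θ.toStage13Params p) j) (Wc j)) →
      ∀ m, m + 1 ≤ k → PlaqSmallOn (Sect2.printedPlaqs s₀.Ω k (m + 1)) (θ.s2.cR * epsOfRecord θ.ν (gOfRecord₁₃ F N θ.toStage13Params p) (m + 1))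
        (Sect2.mixedField (avOfRecord F N p.K) (genSet s₀.Ω k (m + 1)) (Wc (m + 1)) (Wc m)))
    (hS : SLaw₁₃CoPH F N θ p k) :
    ∃ (t : SeqOfRecord F θ.ν θ.τ9.M (gOfRecord₁₃ F N θ.toStage13Params p) p.K k → Sect2.TermValues (F.P p.K) (MatA N) (FluctV N) θ.τ9.M)
      (Ek : SeqOfRecord F θ.ν θ.τ9.M (gOfRecord₁₃ F N θ.toStage13Params p) p.K k → ℝ),
      HasSect2FormAtZS F N (FluctV N) p.K (settingOfRecord₁₃ F N θ.toStage13Params p) k (θ.rzAt p) (WtOfRecord₁₃H F N θ p)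
          (UbgOfRecord₁₃CoP F N θ.toStage13Params p k)
          (fun s₀ t₀ => Sect2.LawsRT (sect2TowerOfRecord F N (FluctV N) p.K (settingOfRecord₁₃ F N θ.toStage13Params p) (θ.rzAt p s₀) s₀ t₀)
            (settingOfRecord₁₃ F N θ.toStage13Params p).lf k)
          (slotsOfRecord F N θ.ν θ.τ9 (EOfRecord₁₃ F N θ.toStage13Params) (wOfRecord₉ F N θ.toStage9Params) θ.ppSel p
            (gOfRecord₁₃ F N θ.toStage13Params p) k) t Ek ∧
      (∀ s₀, IsFluctLocal k (t s₀)) ∧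
      ∀ (s : SeqOfRecord F θ.ν θ.τ9.M (gOfRecord₁₃ F N θ.toStage13Params p) p.K (k + 1)), s.Ω (k + 1) = ∅ →
        -- (P) prefix agreement below `k`
        (∀ j, j < k → (θ.zhAt p s).ζ0 j = (θ.zhAt p s.init).ζ0 j ∧ (θ.zhAt p s).quad j = (θ.zhAt p s.init).quad j) →
        -- (V) the generation-`k` pin with the old front factor
        (∀ (V' : GaugeField (F.P p.K) (k + 1) (SU N)) (U₀ : GaugeField (F.P p.K) k (SU N)),
          (θ.zhAt p s).ζ0 k Set.univ (pairCfgAt (V := FluctV N) k V' U₀) =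
            chiSeqOfRecord F N θ.ν θ.τ9.M (gOfRecord₁₃ F N θ.toStage13Params p) p.K k s.init U₀ *
              wOfRecord₉ F N θ.toStage9Params p (gOfRecord₁₃ F N θ.toStage13Params p) k s U₀ ((avOfRecord F N p.K k).avg U₀)) →
        -- `quad_k(∅) = 0` on the two-scale configurations
        (∀ (V' : GaugeField (F.P p.K) (k + 1) (SU N)) (U₀ : GaugeField (F.P p.K) k (SU N)), (θ.zhAt p s).quad k ∅ (pairCfgAt (V := FluctV N) k V' U₀) = 0) →
        -- `k`-locality of `quad_j(Λ_{j+1})`, `j < k`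
        (∀ j, j < k → ∀ ω ω' : MultiCfg (F.P p.K) (SU N) (FluctV N), (∀ i, i ≤ k → ω i = ω' i) →
          (θ.zhAt p s).quad j (s.init.Λ (j + 1)) ω = (θ.zhAt p s).quad j (s.init.Λ (j + 1)) ω') →
        -- measurability of the residual serving `s′`
        (∀ j (Y : Set (Site (F.P p.K) 0)), Measurable ((θ.zhAt p s).ζ0 j Y)) →
        (∀ j (Λ' : Set (Site (F.P p.K) 0)), Measurable ((θ.zhAt p s).quad j Λ')) →
        -- per old branch: A-fibre domination (K0b)
        (∀ S ∈ admSOfRecord F θ.ν θ.τ9.M (gOfRecord₁₃ F N θ.toStage13Params p) p.K k s.init, ∀ j : ℕ,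
          ∃ ŵ : (↥(Set.toFinite (B10Eq42TorusConstraint.bondsIn j ((s.init.Λ (j + 1))ᶜ ∩ s.init.Ω (j + 1)))).toFinset → FluctV N) → ℝ≥0∞, Measurable ŵ ∧
            (∫⁻ a, ŵ a ∂(Measure.pi fun _ : ↥(Set.toFinite (B10Eq42TorusConstraint.bondsIn j ((s.init.Λ (j + 1))ᶜ ∩ s.init.Ω (j + 1)))).toFinset => (volume : Measure (FluctV N)))) ≠ ⊤ ∧
            ∀ ω, ENNReal.ofReal ((WtOfRecord₁₃H F N θ p s).w j (s.init.Λ (j + 1)) ((s.init.Λ (j + 1))ᶜ ∩ s.init.Ω (j + 1)) (S (j + 1)) ω) ≤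
              ŵ (fun b : ↥(Set.toFinite (B10Eq42TorusConstraint.bondsIn j ((s.init.Λ (j + 1))ᶜ ∩ s.init.Ω (j + 1)))).toFinset => (ω j).2 b)) →
        -- def-T: the 𝐁-terms of the witness at the parent history, READ AT THE EMBEDDED BACKGROUND, are JOINTLY measurable in `(U, A)` (LOCATED residue)
        (∀ (S' : ℕ → Set (Site (F.P p.K) 0)) (j : ℕ) (X : (Sect2.domSys (F.P p.K) θ.τ9.M j).Dom),
          Measurable (fun q : GaugeField (F.P p.K) 0 (SU N) × MSFluct (F.P p.K) (FluctV N) =>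
            ((t s.init).B j X (Sect2.ofBackgroundC (settingOfRecord₁₃ F N θ.toStage13Params p).ι q.1) (S', q.2)).re)) →
        (slotsTOfRecord F N θ.ν θ.τ9 (EOfRecord₁₃ F N θ.toStage13Params) (wOfRecord₉ F N θ.toStage9Params) θ.ppSel p
            (gOfRecord₁₃ F N θ.toStage13Params p) (k + 1) s = 0 ∨
          ∀ᵐ V' ∂fieldMeasure (F.P p.K) (k + 1) (SU N),
            chiSeqOfRecord F N θ.ν θ.τ9.M (gOfRecord₁₃ F N θ.toStage13Params p) p.K (k + 1) s V' ≠ 0 →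
              slotsTOfRecord F N θ.ν θ.τ9 (EOfRecord₁₃ F N θ.toStage13Params) (wOfRecord₉ F N θ.toStage9Params) θ.ppSel p
                  (gOfRecord₁₃ F N θ.toStage13Params p) (k + 1) s V' =
                sect2Slot F N (FluctV N) p.K (settingOfRecord₁₃ F N θ.toStage13Params p) (θ.rzAt p s) (WtOfRecord₁₃H F N θ p s) s
                  (t s.init) (Ek s.init) (UbgOfRecord₁₃CoP F N θ.toStage13Params p (k + 1) s) V') :=
  exists_local_witness_clause_succ_of_sLaw₁₃CoPH_of_sep_of_junctionCharged θ p hsep hU hθ hpos hM₁ hle hk hM hw hPC θ.s2.cR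
    (fun s₀ => readSelOfSeq F p (suppDomOfRecord F θ.ν p.K s₀.Ω) s₀.Ω) hreg
    (sepJunctionCharged_of_solvable θ p hk1 hkK hcR hM₁ h3 hR hε hε3 hε2 hsolv hcov h7) hS

/-- **★★★ THE WITNESS-FIRST NO-EXPANSION 𝐓-STEP FACE WITH THE JUNCTION'S TOP HALF DISCHARGED**: `…SpaceTruncationChargedSep`'s witness-first ★ with hJ REPLACED
by the same rows; conclusion VERBATIM (no row on the witness beyond `hBt`). [cite: Balaban1988Convergent, Theorem p.245, Thm 1 p.262, (2.10) p.256, (2.16)–(2.17) p.257, p.267, (2.28) p.259, (3.24)–(3.25) p.270; Balaban1985Variational, Thm 1 (7)–(8) p.278–279; Balaban1985Averaging, Prop. 2 p.26] -/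
theorem exists_local_witness_clause_succ_of_hasSect2FormAtZS_of_borelB_of_sep_of_solvable (hsep : θ.Provisos₁₃SepCoPH F N) (hU : θ.ZhUnity F N)
    (hθ : θ.Admissible F N) (hpos : θ.s2.Pos) (hM₁ : 0 < θ.ν.M₁) (hle : θ.ν.M₁ ≤ θ.τ9.M) {k : ℕ} (hk : k < p.K) (hM : 1 ≤ θ.τ9.M)
    (hw : Step.InInterval θ.γ k (gOfRecord₁₃ F N θ.toStage13Params p)) (hPC : PartCompat₁₃ F N θ.toStage13Params p k)
    (hreg : ∀ s₀ : SeqOfRecord F θ.ν θ.τ9.M (gOfRecord₁₃ F N θ.toStage13Params p) p.K k,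
      (θ.zhAt p s₀).RegOn F N (FluctV N) θ.ν θ.s2.cR p (gOfRecord₁₃ F N θ.toStage13Params p) (readSelOfSeq F p (suppDomOfRecord F θ.ν p.K s₀.Ω) s₀.Ω))
    (hk1 : 1 ≤ k) (hkK : k ≤ (F.P p.K).m + (F.P p.K).K) (hcR : 2 ≤ θ.s2.cR)
    (h3 : 3 * side (F.P p.K).L θ.ν.M₁ k ≤ cubeSide (F.P p.K).L θ.ν.M₂ (RkOfRecord (F.P p.K).L θ.ν.r (gOfRecord₁₃ F N θ.toStage13Params p k)) k)
    (hR : (F.P p.K).L ^ k + (((F.P p.K).d + 4) * (F.P p.K).L + 2) * (∑ l ∈ Finset.range k, (F.P p.K).L ^ l) + 2 ≤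
      cubeSide (F.P p.K).L θ.ν.M₂ (RkOfRecord (F.P p.K).L θ.ν.r (gOfRecord₁₃ F N θ.toStage13Params p k)) k)
    (hε : 0 < epsOfRecord θ.ν (gOfRecord₁₃ F N θ.toStage13Params p) k)
    (hε3 : (143 * (((((F.P p.K).d + 4 : ℕ) : ℝ)) ^ 2 / 4) ^ 2) * epsOfRecord θ.ν (gOfRecord₁₃ F N θ.toStage13Params p) k ≤ 1 / 3)
    (hε2 : 2 * epsOfRecord θ.ν (gOfRecord₁₃ F N θ.toStage13Params p) k ≤ 2 * ExpMeanLog.deltaSU (Fin N) / ((((F.P p.K).d + 4) * (F.P p.K).L : ℕ) : ℝ) ^ 2)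
    (hsolv : ∀ s₀ : SeqOfRecord F θ.ν θ.τ9.M (gOfRecord₁₃ F N θ.toStage13Params p) p.K k,
      slotsOfRecord F N θ.ν θ.τ9 (EOfRecord₁₃ F N θ.toStage13Params) (wOfRecord₉ F N θ.toStage9Params) θ.ppSel p
        (gOfRecord₁₃ F N θ.toStage13Params p) k s₀ ≠ 0 → Sect2.SeqSeparated θ.ν.M₁ s₀ → ∀ Wc : MSField (F.P p.K) (SU N),
      chiSeqOfRecord F N θ.ν θ.τ9.M (gOfRecord₁₃ F N θ.toStage13Params p) p.K k s₀ (Wc k) ≠ 0 →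
      ∀ a ∈ cubesIn (fun a : ↥(cubeIndices (F.P p.K) (cubeSide (F.P p.K).L θ.ν.M₂ (RkOfRecord (F.P p.K).L θ.ν.r (gOfRecord₁₃ F N θ.toStage13Params p k)) k)) =>
          cubeEnl (F.P p.K) (cubeSide (F.P p.K).L θ.ν.M₂ (RkOfRecord (F.P p.K).L θ.ν.r (gOfRecord₁₃ F N θ.toStage13Params p k)) k) a 0) (s₀.Ω k),
        ∃ U₀, IsMinimizer (avOfRecord F N p.K) {U | PlaqSmall (θ.ν.εreg * (F.P p.K).eta k ^ 2) U}
          (Bj θ.ν.M₁ (cubeEnl (F.P p.K) (cubeSide (F.P p.K).L θ.ν.M₂ (RkOfRecord (F.P p.K).L θ.ν.r (gOfRecord₁₃ F N θ.toStage13Params p k)) k) a 4) k)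
          (avgFamily (avOfRecord F N p.K) (qsstarGIter0 k (Wc k))) U₀)
    (hcov : ∀ s₀ : SeqOfRecord F θ.ν θ.τ9.M (gOfRecord₁₃ F N θ.toStage13Params p) p.K k,
      s₀.Ω k ⊆ ⋃ a ∈ cubesIn (fun a : ↥(cubeIndices (F.P p.K) (cubeSide (F.P p.K).L θ.ν.M₂ (RkOfRecord (F.P p.K).L θ.ν.r (gOfRecord₁₃ F N θ.toStage13Params p k)) k)) =>
          cubeEnl (F.P p.K) (cubeSide (F.P p.K).L θ.ν.M₂ (RkOfRecord (F.P p.K).L θ.ν.r (gOfRecord₁₃ F N θ.toStage13Params p k)) k) a 0) (s₀.Ω k),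
        cubeEnl (F.P p.K) (cubeSide (F.P p.K).L θ.ν.M₂ (RkOfRecord (F.P p.K).L θ.ν.r (gOfRecord₁₃ F N θ.toStage13Params p k)) k) a 0)
    (h7 : ∀ s₀ : SeqOfRecord F θ.ν θ.τ9.M (gOfRecord₁₃ F N θ.toStage13Params p) p.K k,
      slotsOfRecord F N θ.ν θ.τ9 (EOfRecord₁₃ F N θ.toStage13Params) (wOfRecord₉ F N θ.toStage9Params) θ.ppSel p
        (gOfRecord₁₃ F N θ.toStage13Params p) k s₀ ≠ 0 → Sect2.SeqSeparated θ.ν.M₁ s₀ → ∀ Wc : MSField (F.P p.K) (SU N),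
      chiSeqOfRecord F N θ.ν θ.τ9.M (gOfRecord₁₃ F N θ.toStage13Params p) p.K k s₀ (Wc k) ≠ 0 →
      (∀ j, j < k → PlaqSmallOn (plaqsOf (pts j (readSelOfSeq F p (suppDomOfRecord F θ.ν p.K s₀.Ω) s₀.Ω j (s₀.Ω (j + 1))ᶜ)))
        (θ.s2.cR * epsOfRecord θ.ν (gOfRecord₁₃ F N θ.toStage13Params p) j) (Wc j)) →
      ∀ m, m + 1 ≤ k → PlaqSmallOn (Sect2.printedPlaqs s₀.Ω k (m + 1)) (θ.s2.cR * epsOfRecord θ.ν (gOfRecord₁₃ F N θ.toStage13Params p) (m + 1))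
        (Sect2.mixedField (avOfRecord F N p.K) (genSet s₀.Ω k (m + 1)) (Wc (m + 1)) (Wc m)))
    (t₀ : SeqOfRecord F θ.ν θ.τ9.M (gOfRecord₁₃ F N θ.toStage13Params p) p.K k → Sect2.TermValues (F.P p.K) (MatA N) (FluctV N) θ.τ9.M)
    (E₀ : SeqOfRecord F θ.ν θ.τ9.M (gOfRecord₁₃ F N θ.toStage13Params p) p.K k → ℝ)
    (hform₀ : HasSect2FormAtZS F N (FluctV N) p.K (settingOfRecord₁₃ F N θ.toStage13Params p) k (θ.rzAt p) (WtOfRecord₁₃H F N θ p)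
      (UbgOfRecord₁₃CoP F N θ.toStage13Params p k)
      (fun s₀ t' => Sect2.LawsRT (sect2TowerOfRecord F N (FluctV N) p.K (settingOfRecord₁₃ F N θ.toStage13Params p) (θ.rzAt p s₀) s₀ t')
        (settingOfRecord₁₃ F N θ.toStage13Params p).lf k)
      (slotsOfRecord F N θ.ν θ.τ9 (EOfRecord₁₃ F N θ.toStage13Params) (wOfRecord₉ F N θ.toStage9Params) θ.ppSel p (gOfRecord₁₃ F N θ.toStage13Params p) k) t₀ E₀)
    (hBt : ∀ s₀ (S' : ℕ → Set (Site (F.P p.K) 0)) (j : ℕ) (X : (Sect2.domSys (F.P p.K) θ.τ9.M j).Dom),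
      Measurable (fun q : GaugeField (F.P p.K) 0 (SU N) × MSFluct (F.P p.K) (FluctV N) =>
        (t₀ s₀).B j X (Sect2.ofBackgroundC (settingOfRecord₁₃ F N θ.toStage13Params p).ι q.1) (S', q.2))) :
    ∃ (t : SeqOfRecord F θ.ν θ.τ9.M (gOfRecord₁₃ F N θ.toStage13Params p) p.K k → Sect2.TermValues (F.P p.K) (MatA N) (FluctV N) θ.τ9.M)
      (Ek : SeqOfRecord F θ.ν θ.τ9.M (gOfRecord₁₃ F N θ.toStage13Params p) p.K k → ℝ),
      HasSect2FormAtZS F N (FluctV N) p.K (settingOfRecord₁₃ F N θ.toStage13Params p) k (θ.rzAt p) (WtOfRecord₁₃H F N θ p)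
          (UbgOfRecord₁₃CoP F N θ.toStage13Params p k)
          (fun s₀ t₀ => Sect2.LawsRT (sect2TowerOfRecord F N (FluctV N) p.K (settingOfRecord₁₃ F N θ.toStage13Params p) (θ.rzAt p s₀) s₀ t₀)
            (settingOfRecord₁₃ F N θ.toStage13Params p).lf k)
          (slotsOfRecord F N θ.ν θ.τ9 (EOfRecord₁₃ F N θ.toStage13Params) (wOfRecord₉ F N θ.toStage9Params) θ.ppSel p
            (gOfRecord₁₃ F N θ.toStage13Params p) k) t Ek ∧
      (∀ s₀, IsFluctLocal k (t s₀)) ∧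
      ∀ (s : SeqOfRecord F θ.ν θ.τ9.M (gOfRecord₁₃ F N θ.toStage13Params p) p.K (k + 1)), s.Ω (k + 1) = ∅ →
        -- (P) prefix agreement below `k`
        (∀ j, j < k → (θ.zhAt p s).ζ0 j = (θ.zhAt p s.init).ζ0 j ∧ (θ.zhAt p s).quad j = (θ.zhAt p s.init).quad j) →
        -- (V) the generation-`k` pin with the old front factor
        (∀ (V' : GaugeField (F.P p.K) (k + 1) (SU N)) (U₀ : GaugeField (F.P p.K) k (SU N)),
          (θ.zhAt p s).ζ0 k Set.univ (pairCfgAt (V := FluctV N) k V' U₀) =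
            chiSeqOfRecord F N θ.ν θ.τ9.M (gOfRecord₁₃ F N θ.toStage13Params p) p.K k s.init U₀ *
              wOfRecord₉ F N θ.toStage9Params p (gOfRecord₁₃ F N θ.toStage13Params p) k s U₀ ((avOfRecord F N p.K k).avg U₀)) →
        -- `quad_k(∅) = 0` on the two-scale configurations
        (∀ (V' : GaugeField (F.P p.K) (k + 1) (SU N)) (U₀ : GaugeField (F.P p.K) k (SU N)), (θ.zhAt p s).quad k ∅ (pairCfgAt (V := FluctV N) k V' U₀) = 0) →
        -- `k`-locality of `quad_j(Λ_{j+1})`, `j < k`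
        (∀ j, j < k → ∀ ω ω' : MultiCfg (F.P p.K) (SU N) (FluctV N), (∀ i, i ≤ k → ω i = ω' i) →
          (θ.zhAt p s).quad j (s.init.Λ (j + 1)) ω = (θ.zhAt p s).quad j (s.init.Λ (j + 1)) ω') →
        -- measurability of the residual serving `s′`
        (∀ j (Y : Set (Site (F.P p.K) 0)), Measurable ((θ.zhAt p s).ζ0 j Y)) →
        (∀ j (Λ' : Set (Site (F.P p.K) 0)), Measurable ((θ.zhAt p s).quad j Λ')) →
        -- per old branch: A-fibre domination (K0b)
        (∀ S ∈ admSOfRecord F θ.ν θ.τ9.M (gOfRecord₁₃ F N θ.toStage13Params p) p.K k s.init, ∀ j : ℕ,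
          ∃ ŵ : (↥(Set.toFinite (B10Eq42TorusConstraint.bondsIn j ((s.init.Λ (j + 1))ᶜ ∩ s.init.Ω (j + 1)))).toFinset → FluctV N) → ℝ≥0∞, Measurable ŵ ∧
            (∫⁻ a, ŵ a ∂(Measure.pi fun _ : ↥(Set.toFinite (B10Eq42TorusConstraint.bondsIn j ((s.init.Λ (j + 1))ᶜ ∩ s.init.Ω (j + 1)))).toFinset => (volume : Measure (FluctV N)))) ≠ ⊤ ∧
            ∀ ω, ENNReal.ofReal ((WtOfRecord₁₃H F N θ p s).w j (s.init.Λ (j + 1)) ((s.init.Λ (j + 1))ᶜ ∩ s.init.Ω (j + 1)) (S (j + 1)) ω) ≤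
              ŵ (fun b : ↥(Set.toFinite (B10Eq42TorusConstraint.bondsIn j ((s.init.Λ (j + 1))ᶜ ∩ s.init.Ω (j + 1)))).toFinset => (ω j).2 b)) →
        (slotsTOfRecord F N θ.ν θ.τ9 (EOfRecord₁₃ F N θ.toStage13Params) (wOfRecord₉ F N θ.toStage9Params) θ.ppSel p
            (gOfRecord₁₃ F N θ.toStage13Params p) (k + 1) s = 0 ∨
          ∀ᵐ V' ∂fieldMeasure (F.P p.K) (k + 1) (SU N),
            chiSeqOfRecord F N θ.ν θ.τ9.M (gOfRecord₁₃ F N θ.toStage13Params p) p.K (k + 1) s V' ≠ 0 →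
              slotsTOfRecord F N θ.ν θ.τ9 (EOfRecord₁₃ F N θ.toStage13Params) (wOfRecord₉ F N θ.toStage9Params) θ.ppSel p
                  (gOfRecord₁₃ F N θ.toStage13Params p) (k + 1) s V' =
                sect2Slot F N (FluctV N) p.K (settingOfRecord₁₃ F N θ.toStage13Params p) (θ.rzAt p s) (WtOfRecord₁₃H F N θ p s) s
                  (t s.init) (Ek s.init) (UbgOfRecord₁₃CoP F N θ.toStage13Params p (k + 1) s) V') :=
  exists_local_witness_clause_succ_of_hasSect2FormAtZS_of_borelB_of_sep_of_junctionCharged θ p hsep hU hθ hpos hM₁ hle hk hM hw hPC θ.s2.cR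
    (fun s₀ => readSelOfSeq F p (suppDomOfRecord F θ.ν p.K s₀.Ω) s₀.Ω) hreg
    (sepJunctionCharged_of_solvable θ p hk1 hkK hcR hM₁ h3 hR hε hε3 hε2 hsolv hcov h7) t₀ E₀ hform₀ hBt

end Summit.QuantumFields.YangMills.Theorems.BalabanUVNodesN11ChargedSepJunctionOfSolvable

end
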